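import Summits.AnomalousDissipation.AnomalousDissipation.Theorems.GenericRunawayStokesScaling.Negative.Frame

/-!
# Negative knowledge for the crux `MirrorVariety.GenericRunawayStokesScaling` (stmt-AnomalousDissipation-2990), III:
# the regularity hypothesis is load-bearing — an unbounded `ν = 0` fibre at `N = 2`

Certified copy of §5 of the cdisprove work file.  `GenericRunawayStokesScalingWithoutRegularity` — the crux verbatim
with the regularity hypothesis deleted — is FALSE (`genericRunawayStokesScaling_false_without_regularity`): at
resolution `N = 2` the real solenoidal force `g = Q(W₀)` (`W₀` on `±(1,0,0), ±(0,1,0)`) has the whole line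
`{(sU₀ + W₀, 0) : s ∈ ℝ}` (`U₀` on `±(0,0,2)`) inside `V_2(g)`, because `±(0,0,2)` cannot interact with
`{±(0,0,2), ±(1,0,0), ±(0,1,0)}` inside the punctured ball `S_2`; so `ν²‖c‖² = 0` at arbitrarily large `‖c‖`
(`exists_unbounded_zero_viscosity_fibre`, `not_stokesRate_gW`).  Part IV shows this `g` is NOT a regular value.
Supports stmt-AnomalousDissipation-2990.
-/

set_option linter.dupNamespace false

noncomputable section

open scoped BigOperators InnerProductSpace ComplexConjugate
open Filter Set Function

namespace Summit.AnomalousDissipation.AnomalousDissipation.Theorems.GenericRunawayStokesScaling.Negative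

open Literature.Analysis.FunctionSpaces Literature.Analysis.FunctionSpaces.Torus
open Literature.Analysis.FluidPDE Literature.Analysis.FluidPDE.Torus
open Summit.AnomalousDissipation.AnomalousDissipation.Theses.MirrorVariety

/-! ## §5 LOAD-BEARING HYPOTHESIS: regularity.  An unbounded `ν = 0` fibre at `N = 2`

Witness.  `k₀ = (0,0,2)`, `p = (1,0,0)`, `q = (0,1,0)`; `U₀` = the real single mode `e₁ cos(4π x₃)`-type
vector supported on `±k₀` with polarisation `e₁ ⊥ k₀`; `W₀` supported on `±p` (polarisation `(0,1,1) ⊥ p`)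
and `±q` (polarisation `(1,0,1) ⊥ q`); `g := Q(W₀) = -galerkinRHS S 0 0 W₀`.  Every interaction of `±k₀`
with `supp(U₀) ∪ supp(W₀)` lands OUTSIDE the punctured ball `S_2` (`|k₀ ± p|² = 5`, `2k₀ ∉ S_2`,
`k₀ - k₀ = 0 ∉ S_2`), so `Q(sU₀ + W₀) = Q(W₀) = g` for every real `s`: the whole line
`{(sU₀ + W₀, 0) : s ∈ ℝ}` lies in `V_2(g)`, with `ν²‖c‖² = 0` and `‖c‖ ≥ |s|`.  And `g ≠ 0`
(`ĝ_{p+q} = Π_{(1,1,0)} 2πi[(a_p·q) a_q + (a_q·p) a_p] = 2πi (0,0,2)`).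
This `g` is NOT a regular value (the `k₀`-slot of `Range DF(sU₀+W₀, 0)` is the line `ℝ·s a₀` inside
the 4-dimensional `k₀`-slot of the Galerkin space — recorded in the VERDICT block, not yet formalised):
exactly the degeneration the regularity hypothesis is there to exclude. -/

/-- `k₀ = (0,0,2)`. -/
def k0 : Fin 3 → ℤ := ![0, 0, 2]
/-- `p = (1,0,0)`. -/
def p1 : Fin 3 → ℤ := ![1, 0, 0]
/-- `q = (0,1,0)`. -/
def q1 : Fin 3 → ℤ := ![0, 1, 0]

/-- Polarisation of `U₀`: `e₀ ⊥ k₀`. -/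
def aU : (EuclideanSpace ℂ (Fin 3)) := EuclideanSpace.single 0 1
/-- Polarisation at `±p`: `(0,1,1) ⊥ p`. -/
def aP : (EuclideanSpace ℂ (Fin 3)) := EuclideanSpace.single 1 1 + EuclideanSpace.single 2 1
/-- Polarisation at `±q`: `(1,0,1) ⊥ q`. -/
def aQ : (EuclideanSpace ℂ (Fin 3)) := EuclideanSpace.single 0 1 + EuclideanSpace.single 2 1

/-- Two integer vectors differing in one coordinate are different. [folklore] -/
theorem vec_ne {a b : Fin 3 → ℤ} (i : Fin 3) (h : a i ≠ b i) : a ≠ b := fun e => h (congrFun e i)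

/-- `k₀ ∈ S_2`. [folklore] -/
theorem k0_mem : k0 ∈ PB 2 :=
  mem_PB_iff.2 ⟨vec_ne 2 (by simp [k0, Matrix.cons_val_two, Matrix.head_cons, Matrix.tail_cons]), by norm_num [k0, Fin.sum_univ_three, Matrix.cons_val_zero, Matrix.cons_val_one, Matrix.cons_val_two, Matrix.head_cons, Matrix.tail_cons]⟩
/-- `p ∈ S_2`. [folklore] -/
theorem p1_mem : p1 ∈ PB 2 :=
  mem_PB_iff.2 ⟨vec_ne 0 (by simp [p1, Matrix.cons_val_zero]), by norm_num [p1, Fin.sum_univ_three, Matrix.cons_val_zero, Matrix.cons_val_one, Matrix.cons_val_two, Matrix.head_cons, Matrix.tail_cons]⟩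
/-- `q ∈ S_2`. [folklore] -/
theorem q1_mem : q1 ∈ PB 2 :=
  mem_PB_iff.2 ⟨vec_ne 1 (by simp [q1, Matrix.cons_val_zero, Matrix.cons_val_one]), by norm_num [q1, Fin.sum_univ_three, Matrix.cons_val_zero, Matrix.cons_val_one, Matrix.cons_val_two, Matrix.head_cons, Matrix.tail_cons]⟩
/-- `p + q ∈ S_2`. [folklore] -/
theorem pq_mem : p1 + q1 ∈ PB 2 :=
  mem_PB_iff.2 ⟨vec_ne 0 (by simp [p1, q1, Matrix.cons_val_zero]), by norm_num [p1, q1, Fin.sum_univ_three, Matrix.cons_val_zero, Matrix.cons_val_one, Matrix.cons_val_two, Matrix.head_cons, Matrix.tail_cons]⟩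

/-- A vector outside the punctured ball: zero, or too long. [folklore] -/
theorem not_mem_PB_of {N : ℕ} {k : Fin 3 → ℤ} (h : k = 0 ∨ (N : ℤ) ^ 2 < ∑ i, k i ^ 2) : k ∉ PB N := by
  rw [mem_PB_iff]
  rintro ⟨h0, hle⟩
  rcases h with h | h
  · exact h0 h
  · omega

/-- The truncated-Euler direction `U₀` (single real mode on `±k₀`). -/
def U0 : ↥(PB 2) → (EuclideanSpace ℂ (Fin 3)) := fun k => if (k : Fin 3 → ℤ) = k0 ∨ (k : Fin 3 → ℤ) = -k0 then aU else 0
/-- The bounded profile `W₀` (real modes on `±p`, `±q`). -/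
def W0 : ↥(PB 2) → (EuclideanSpace ℂ (Fin 3)) := fun k =>
  if (k : Fin 3 → ℤ) = p1 ∨ (k : Fin 3 → ℤ) = -p1 then aP
  else if (k : Fin 3 → ℤ) = q1 ∨ (k : Fin 3 → ℤ) = -q1 then aQ else 0

/-- Unfolding of `U0`. [folklore] -/
theorem U0_apply (k : ↥(PB 2)) :
    U0 k = if (k : Fin 3 → ℤ) = k0 ∨ (k : Fin 3 → ℤ) = -k0 then aU else 0 := rfl
/-- Unfolding of `W0`. [folklore] -/
theorem W0_apply (k : ↥(PB 2)) :
    W0 k = if (k : Fin 3 → ℤ) = p1 ∨ (k : Fin 3 → ℤ) = -p1 then aP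
      else if (k : Fin 3 → ℤ) = q1 ∨ (k : Fin 3 → ℤ) = -q1 then aQ else 0 := rfl

/-- The polarisation `a₀` is real. [folklore] -/
@[simp] theorem conjVec_aU : EuclideanSpace.conjVec aU = aU := by
  ext i; fin_cases i <;> simp [aU]
/-- The polarisation `a_p` is real. [folklore] -/
@[simp] theorem conjVec_aP : EuclideanSpace.conjVec aP = aP := by
  ext i; fin_cases i <;> simp [aP]
/-- The polarisation `a_q` is real. [folklore] -/
@[simp] theorem conjVec_aQ : EuclideanSpace.conjVec aQ = aQ := by
  ext i; fin_cases i <;> simp [aQ]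

/-- `‖a₀‖ = 1`. -/
theorem norm_aU : ‖aU‖ = 1 := by
  simp [aU]

/-- Symmetry of the defining conditions under `k ↦ -k`. [folklore] -/
theorem or_neg_iff {l k v : Fin 3 → ℤ} (hl : l = -k) : (l = v ∨ l = -v) ↔ (k = v ∨ k = -v) := by
  rw [hl, neg_inj, neg_eq_iff_eq_neg, or_comm]

/-- `U₀` lies in the Galerkin space. -/
theorem U0_mem : U0 ∈ galerkinSubspace (PB 2) := by
  refine ⟨?_, ?_⟩
  · intro k l hl
    by_cases h : (k : Fin 3 → ℤ) = k0 ∨ (k : Fin 3 → ℤ) = -k0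
    · rw [U0_apply, U0_apply, if_pos h, if_pos ((or_neg_iff hl).2 h), conjVec_aU]
    · rw [U0_apply, U0_apply, if_neg h, if_neg (fun h' => h ((or_neg_iff hl).1 h')),
        EuclideanSpace.conjVec_zero]
  · intro k
    rw [U0_apply]
    split_ifs with h
    · rcases h with h | h <;> simp [h, k0, aU, Matrix.cons_val_zero]
    · simp

/-- `W₀` lies in the Galerkin space. -/
theorem W0_mem : W0 ∈ galerkinSubspace (PB 2) := by
  refine ⟨?_, ?_⟩
  · intro k l hl
    by_cases h : (k : Fin 3 → ℤ) = p1 ∨ (k : Fin 3 → ℤ) = -p1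
    · rw [W0_apply, W0_apply, if_pos h, if_pos ((or_neg_iff hl).2 h), conjVec_aP]
    · by_cases h' : (k : Fin 3 → ℤ) = q1 ∨ (k : Fin 3 → ℤ) = -q1
      · rw [W0_apply, W0_apply, if_neg h, if_neg (fun h'' => h ((or_neg_iff hl).1 h'')), if_pos h',
          if_pos ((or_neg_iff hl).2 h'), conjVec_aQ]
      · rw [W0_apply, W0_apply, if_neg h, if_neg (fun h'' => h ((or_neg_iff hl).1 h'')), if_neg h',
          if_neg (fun h'' => h' ((or_neg_iff hl).1 h'')), EuclideanSpace.conjVec_zero]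
  · intro k
    rw [W0_apply]
    split_ifs with h h'
    · rcases h with h | h <;> simp [h, p1, aP, Fin.sum_univ_three, Matrix.cons_val_zero, Matrix.cons_val_one, Matrix.cons_val_two, Matrix.head_cons, Matrix.tail_cons]
    · rcases h' with h' | h' <;> simp [h', q1, aQ, Fin.sum_univ_three, Matrix.cons_val_zero, Matrix.cons_val_one, Matrix.cons_val_two, Matrix.head_cons, Matrix.tail_cons]
    · simp

/-- Support of `U₀`. -/
theorem supp_U0 {l : Fin 3 → ℤ} (h : coeffExt (PB 2) U0 l ≠ 0) : l = k0 ∨ l = -k0 := by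
  by_contra hne
  apply h
  by_cases hl : l ∈ PB 2
  · rw [coeffExt_of_mem _ hl, U0_apply, if_neg hne]
  · exact coeffExt_of_not_mem _ hl

/-- Support of `W₀`. -/
theorem supp_W0 {l : Fin 3 → ℤ} (h : coeffExt (PB 2) W0 l ≠ 0) :
    (l = p1 ∨ l = -p1) ∨ (l = q1 ∨ l = -q1) := by
  by_contra hne
  push Not at hne
  apply h
  by_cases hl : l ∈ PB 2
  · rw [coeffExt_of_mem _ hl, W0_apply, if_neg (not_or.2 hne.1), if_neg (not_or.2 hne.2)]
  · exact coeffExt_of_not_mem _ hl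

/-- A convection symbol vanishes when no pair of supported frequencies sums to `k`. [folklore] -/
theorem convectionCoeff_eq_zero_of_support {S : Finset (Fin 3 → ℤ)} {c c' : (Fin 3 → ℤ) → (EuclideanSpace ℂ (Fin 3))}
    {k : Fin 3 → ℤ} (h : ∀ l ∈ S, ∀ m ∈ S, c l ≠ 0 → c' m ≠ 0 → l + m ≠ k) :
    convectionCoeff S c c' k = 0 := by
  rw [convectionCoeff_def]
  refine Finset.sum_eq_zero fun l hl => Finset.sum_eq_zero fun m hm => ?_
  split_ifs with hlm
  · by_cases hc : c l = 0
    · simp [hc]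
    · by_cases hc' : c' m = 0
      · simp [hc']
      · exact absurd hlm (h l hl m hm hc hc')
  · rfl

/-- **Lattice bookkeeping**: `±k₀ + m ∉ S_2` for every `m ∈ supp U₀ ∪ supp W₀`. -/
theorem k0_add_not_mem {l m : Fin 3 → ℤ} (hl : l = k0 ∨ l = -k0)
    (hm : (m = k0 ∨ m = -k0) ∨ (m = p1 ∨ m = -p1) ∨ (m = q1 ∨ m = -q1)) : l + m ∉ PB 2 := by
  apply not_mem_PB_of
  rcases hl with rfl | rfl <;> rcases hm with (rfl | rfl) | (rfl | rfl) | (rfl | rfl) <;>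
    norm_num [k0, p1, q1, Fin.sum_univ_three, Matrix.cons_val_zero, Matrix.cons_val_one, Matrix.cons_val_two, Matrix.head_cons, Matrix.tail_cons] <;>
    exact Subsingleton.elim _ _

/-- The same with the summands exchanged. -/
theorem add_k0_not_mem {l m : Fin 3 → ℤ} (hm : m = k0 ∨ m = -k0)
    (hl : (l = k0 ∨ l = -k0) ∨ (l = p1 ∨ l = -p1) ∨ (l = q1 ∨ l = -q1)) : l + m ∉ PB 2 := by
  rw [add_comm]; exact k0_add_not_mem hm hl

/-- `B(U₀, U₀) = 0` on `S_2`. [folklore] -/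
theorem cc_U0_U0 {k : Fin 3 → ℤ} (hk : k ∈ PB 2) :
    convectionCoeff (PB 2) (coeffExt _ U0) (coeffExt _ U0) k = 0 :=
  convectionCoeff_eq_zero_of_support fun _ _ _ _ hl hm heq =>
    k0_add_not_mem (supp_U0 hl) (Or.inl (supp_U0 hm)) (heq ▸ hk)

/-- `B(U₀, W₀) = 0` on `S_2`. [folklore] -/
theorem cc_U0_W0 {k : Fin 3 → ℤ} (hk : k ∈ PB 2) :
    convectionCoeff (PB 2) (coeffExt _ U0) (coeffExt _ W0) k = 0 :=
  convectionCoeff_eq_zero_of_support fun _ _ _ _ hl hm heq =>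
    k0_add_not_mem (supp_U0 hl) (Or.inr (supp_W0 hm)) (heq ▸ hk)

/-- `B(W₀, U₀) = 0` on `S_2`. [folklore] -/
theorem cc_W0_U0 {k : Fin 3 → ℤ} (hk : k ∈ PB 2) :
    convectionCoeff (PB 2) (coeffExt _ W0) (coeffExt _ U0) k = 0 :=
  convectionCoeff_eq_zero_of_support fun _ _ _ _ hl hm heq =>
    add_k0_not_mem (supp_U0 hm) (Or.inr (supp_W0 hl)) (heq ▸ hk)

/-- **The nonlinearity does not see `U₀`**: `B(sU₀ + W₀, sU₀ + W₀) = B(W₀, W₀)` on `S_2`. -/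
theorem cc_line (s : ℝ) {k : Fin 3 → ℤ} (hk : k ∈ PB 2) :
    convectionCoeff (PB 2) (coeffExt _ (s • U0 + W0)) (coeffExt _ (s • U0 + W0)) k =
      convectionCoeff (PB 2) (coeffExt _ W0) (coeffExt _ W0) k := by
  rw [coeffExt_add, coeffExt_smul, real_smul_coeff]
  rw [convectionCoeff_add_left, convectionCoeff_add_right, convectionCoeff_add_right,
    convectionCoeff_smul_left, convectionCoeff_smul_left, convectionCoeff_smul_right,
    convectionCoeff_smul_right, cc_U0_U0 hk, cc_U0_W0 hk, cc_W0_U0 hk]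
  simp

/-- The Galerkin field at `ν = 0`: `F(c, 0)_k = Π_k ĝ_k - Π_k B(c,c)_k`. [folklore] -/
theorem galerkinRHS_zero_visc {S : Finset (Fin 3 → ℤ)} (g c : ↥S → (EuclideanSpace ℂ (Fin 3))) (k : ↥S) :
    galerkinRHS S 0 g c k = leraySym (k : Fin 3 → ℤ) (g k) -
      leraySym (k : Fin 3 → ℤ) (convectionCoeff S (coeffExt S c) (coeffExt S c) k) := by
  rw [galerkinRHS_apply, galerkinField_def, coeffExt_coe, leraySym_sub]
  simp

/-- The force of the witness: `g := Q(W₀) = -F(W₀, 0; g = 0)`. -/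
def gW : ↥(PB 2) → (EuclideanSpace ℂ (Fin 3)) := -galerkinRHS (PB 2) 0 0 W0

/-- `ĝ_k = Π_k B(W₀,W₀)_k`. [folklore] -/
theorem gW_apply (k : ↥(PB 2)) :
    gW k = leraySym (k : Fin 3 → ℤ) (convectionCoeff (PB 2) (coeffExt _ W0) (coeffExt _ W0) k) := by
  rw [gW, Pi.neg_apply, galerkinRHS_zero_visc]
  simp

/-- `g` is a real solenoidal force vector. -/
theorem gW_mem : gW ∈ galerkinSubspace (PB 2) :=
  Submodule.neg_mem _ (galerkinRHS_mem 0 (PB_symm 2) (galerkinSubspace (PB 2)).zero_mem.1 W0_mem)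

/-- **The line of zeros**: `F(sU₀ + W₀, 0) = 0` for every real `s`. -/
theorem line_zero (s : ℝ) : galerkinRHS (PB 2) 0 gW (s • U0 + W0) = 0 := by
  funext k
  rw [galerkinRHS_zero_visc, leraySym_apply_of_mem gW_mem, gW_apply, cc_line s k.2, Pi.zero_apply,
    sub_self]

/-- The line lies in the Galerkin space. -/
theorem line_mem (s : ℝ) : s • U0 + W0 ∈ galerkinSubspace (PB 2) :=
  Submodule.add_mem _ (Submodule.smul_mem _ s U0_mem) W0_mem

/-- The line is unbounded: `‖sU₀ + W₀‖ ≥ |s|` (look at the `k₀`-coefficient). -/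
theorem norm_line_ge (s : ℝ) : |s| ≤ ‖s • U0 + W0‖ := by
  have hk : (s • U0 + W0) ⟨k0, k0_mem⟩ = (s : ℂ) • aU := by
    rw [Pi.add_apply, Pi.smul_apply, U0_apply, if_pos (Or.inl rfl), W0_apply,
      if_neg, if_neg, add_zero]
    · rfl
    · exact not_or.2 ⟨vec_ne 1 (by simp [k0, q1, Matrix.cons_val_zero, Matrix.cons_val_one]), vec_ne 1 (by simp [k0, q1, Matrix.cons_val_zero, Matrix.cons_val_one])⟩
    · exact not_or.2 ⟨vec_ne 0 (by simp [k0, p1, Matrix.cons_val_zero]), vec_ne 0 (by simp [k0, p1, Matrix.cons_val_zero])⟩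
  calc |s| = ‖(s • U0 + W0) ⟨k0, k0_mem⟩‖ := by
        rw [hk, norm_smul, norm_aU, mul_one, Complex.norm_real, Real.norm_eq_abs]
    _ ≤ ‖s • U0 + W0‖ := norm_le_pi_norm _ _

/-! ### `g ≠ 0`: the `(p+q)`-coefficient -/

/-- The `p`-coefficient of `W₀`. [folklore] -/
theorem extW0_p1 : coeffExt (PB 2) W0 p1 = aP := by
  rw [coeffExt_of_mem _ p1_mem, W0_apply, if_pos (Or.inl rfl)]

/-- The `q`-coefficient of `W₀`. [folklore] -/
theorem extW0_q1 : coeffExt (PB 2) W0 q1 = aQ := by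
  rw [coeffExt_of_mem _ q1_mem, W0_apply, if_neg, if_pos (Or.inl rfl)]
  exact not_or.2 ⟨vec_ne 0 (by simp [p1, q1, Matrix.cons_val_zero]), vec_ne 0 (by simp [p1, q1, Matrix.cons_val_zero])⟩

/-- `B(W₀, W₀)_{p+q} = 2πi (a_q + a_p)`: only the pairs `(p,q)` and `(q,p)` contribute. -/
theorem cc_W0_pq :
    convectionCoeff (PB 2) (coeffExt _ W0) (coeffExt _ W0) (p1 + q1) =
      (2 * Real.pi * Complex.I) • aQ + (2 * Real.pi * Complex.I) • aP := by
  have hp_ne_q : p1 ≠ q1 := vec_ne 0 (by simp [p1, q1, Matrix.cons_val_zero])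
  -- frequencies `l ∈ supp W₀ \ {p, q}` cannot reach `p + q`
  have hreach : ∀ l ∈ PB 2, l ≠ p1 → l ≠ q1 → ∀ m ∈ PB 2, coeffExt (PB 2) W0 l ≠ 0 → l + m ≠ p1 + q1 := by
    intro l _ hlp hlq m hm hl heq
    have hm' : m = p1 + q1 - l := eq_sub_of_add_eq' heq
    rcases supp_W0 hl with (rfl | rfl) | (rfl | rfl)
    · exact hlp rfl
    · rw [hm'] at hm
      exact not_mem_PB_of (Or.inr (by norm_num [p1, q1, Fin.sum_univ_three, Matrix.cons_val_zero, Matrix.cons_val_one, Matrix.cons_val_two, Matrix.head_cons, Matrix.tail_cons])) hm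
    · exact hlq rfl
    · rw [hm'] at hm
      exact not_mem_PB_of (Or.inr (by norm_num [p1, q1, Fin.sum_univ_three, Matrix.cons_val_zero, Matrix.cons_val_one, Matrix.cons_val_two, Matrix.head_cons, Matrix.tail_cons])) hm
  rw [convectionCoeff_def, Finset.sum_eq_add_of_mem p1 q1 p1_mem q1_mem hp_ne_q]
  · congr 1
    · -- `l = p`: only `m = q`
      rw [Finset.sum_eq_single_of_mem q1 q1_mem]
      · rw [if_pos rfl, extW0_p1, extW0_q1]
        congr 1
        simp [aP, q1, Fin.sum_univ_three, Matrix.cons_val_zero, Matrix.cons_val_one, Matrix.cons_val_two, Matrix.head_cons, Matrix.tail_cons]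
      · intro m _ hmq
        rw [if_neg]
        intro heq
        exact hmq (add_left_cancel heq)
    · -- `l = q`: only `m = p`
      rw [Finset.sum_eq_single_of_mem p1 p1_mem]
      · rw [if_pos (add_comm _ _), extW0_p1, extW0_q1]
        congr 1
        simp [aQ, p1, Fin.sum_univ_three, Matrix.cons_val_zero, Matrix.cons_val_one, Matrix.cons_val_two, Matrix.head_cons, Matrix.tail_cons]
      · intro m _ hmp
        rw [if_neg]
        intro heq
        rw [add_comm p1 q1] at heq
        exact hmp (add_left_cancel heq)
  · intro l hl hne
    refine Finset.sum_eq_zero fun m hm => ?_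
    by_cases hWl : coeffExt (PB 2) W0 l = 0
    · simp [hWl]
    · rw [if_neg (hreach l hl hne.1 hne.2 m hm hWl)]

/-- The third coordinate of `ĝ_{p+q}` is `4πi`. -/
theorem gW_pq_two : gW ⟨p1 + q1, pq_mem⟩ 2 = 4 * Real.pi * Complex.I := by
  rw [gW_apply]
  change leraySym (p1 + q1) _ 2 = _
  rw [cc_W0_pq, leraySym_def]
  simp [aP, aQ, p1, q1, freqVec_apply, Matrix.cons_val_two, Matrix.head_cons, Matrix.tail_cons]
  ring

/-- Hence `g ≠ 0`. -/
theorem gW_ne_zero : gW ≠ 0 := by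
  intro h
  have h2 := gW_pq_two
  rw [h, Pi.zero_apply, PiLp.zero_apply] at h2
  have h3 : (4 * Real.pi * Complex.I : ℂ) ≠ 0 := by simp [Real.pi_ne_zero, Complex.I_ne_zero]
  exact h3 h2.symm

/-! ### The refutation of the crux-without-regularity -/

/-- The crux with the REGULARITY hypothesis deleted (everything else verbatim). -/
def GenericRunawayStokesScalingWithoutRegularity : Prop :=
  ∀ (N : ℕ) (S : Finset (Fin 3 → ℤ)), S = (freqBall N).erase 0 → ∀ g : ↥S → (EuclideanSpace ℂ (Fin 3)),
    g ∈ galerkinSubspace S → g ≠ 0 → ∀ V : Set ((↥S → (EuclideanSpace ℂ (Fin 3))) × ℝ),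
      V = {z | z.1 ∈ galerkinSubspace S ∧ galerkinRHS S z.2 g z.1 = 0} →
        ∃ M c₀ : ℝ, 0 < c₀ ∧ ∀ z ∈ V, M ≤ ‖z.1‖ → c₀ ≤ z.2 ^ 2 * ‖z.1‖ ^ 2

/-- The line, as points of the variety `V_2(g)`. -/
theorem line_mem_variety (s : ℝ) :
    ((s • U0 + W0, (0 : ℝ)) : (↥(PB 2) → (EuclideanSpace ℂ (Fin 3))) × ℝ) ∈ variety (PB 2) gW := by
  refine ⟨line_mem s, ?_⟩
  show galerkinRHS (PB 2) 0 gW (s • U0 + W0) = 0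
  exact line_zero s

/-- `StokesRate` FAILS for `g = Q(W₀)` at `N = 2`. -/
theorem not_stokesRate_gW : ¬ StokesRate (PB 2) gW := by
  intro h
  obtain ⟨M, c₀, hc₀, hM⟩ := h
  have hnorm : M ≤ ‖|M| • U0 + W0‖ :=
    (le_abs_self M).trans ((abs_abs M).ge.trans (norm_line_ge |M|))
  have h1 := hM _ (line_mem_variety |M|) hnorm
  have h2 : ((|M| • U0 + W0, (0 : ℝ)) : (↥(PB 2) → (EuclideanSpace ℂ (Fin 3))) × ℝ).2 ^ 2 *
      ‖((|M| • U0 + W0, (0 : ℝ)) : (↥(PB 2) → (EuclideanSpace ℂ (Fin 3))) × ℝ).1‖ ^ 2 = 0 := by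
    show (0 : ℝ) ^ 2 * ‖|M| • U0 + W0‖ ^ 2 = 0
    ring
  linarith

/-- **Any proof of the crux must use the regularity hypothesis**: with it deleted the statement is
FALSE at `N = 2` — the force `g = Q(W₀) ≠ 0` has the whole line `{(sU₀ + W₀, 0)}` of zeros at
`ν = 0`, of norm `≥ |s|` and with `ν²‖c‖² = 0`. -/
theorem genericRunawayStokesScaling_false_without_regularity :
    ¬ GenericRunawayStokesScalingWithoutRegularity := by
  intro h
  exact not_stokesRate_gW (h 2 (PB 2) rfl gW gW_mem gW_ne_zero (variety (PB 2) gW) rfl)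

/-- The same witness in positive form, for the provers: an explicit nonzero force at `N = 2` whose
`ν = 0` fibre is unbounded (so `StokesRate` fails for it). -/
theorem exists_unbounded_zero_viscosity_fibre :
    ∃ g : ↥(PB 2) → (EuclideanSpace ℂ (Fin 3)), g ∈ galerkinSubspace (PB 2) ∧ g ≠ 0 ∧
      (∀ s : ℝ, ((s • U0 + W0, (0 : ℝ)) : (↥(PB 2) → (EuclideanSpace ℂ (Fin 3))) × ℝ) ∈ variety (PB 2) g) ∧
        ¬ StokesRate (PB 2) g :=
  ⟨gW, gW_mem, gW_ne_zero, line_mem_variety, not_stokesRate_gW⟩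



end Summit.AnomalousDissipation.AnomalousDissipation.Theorems.GenericRunawayStokesScaling.Negative
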